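import Summits.BirchSwinnertonDyer.BirchSwinnertonDyer.Theorems.BiquadraticEisensteinDescentHeegnerTwistCouplingInSupplyThreeSquaresPinCorner
import HarnessLib

set_option linter.dupNamespace false -- `Summit.BirchSwinnertonDyer.BirchSwinnertonDyer.Theorems.…` (summit = sub)
set_option autoImplicit false

/-!
# Crux `HeegnerTwistCouplingInSupply` (stmt-BirchSwinnertonDyer-21381) — the card's third corner `CruxOnE2pCornerMod5`
# on its `p ≡ 7 (mod 8)` half (card `three-squares-heegner-pin`), PROVED modulo five named facts

Route `BiquadraticEisensteinDescent` (cell `pub/bsd-wall`, row-12 line lead `bsd-line-ibd-p1` g10). Companion of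
`…ThreeSquaresPinCorner.lean` (p645024: `CruxOnE2pCornerMod12`, `CruxOnEpCornerMod24`). Here the DUAL-pin corner: for a
prime `p ≡ 7 (mod 8)`, `p ≡ ±1 (mod 5)`, the dual pin `ℓ′ < p`, `ℓ′ ≡ 3 (mod 8)`, `(ℓ′/p) = −1` (p643125) with the partner
`5` gives the Heegner field `K′ = ℚ(√−5ℓ′)` of `N(E_{2p}) = 64p²` (`−5ℓ′ ≡ 1 (mod 8)`, `(−5ℓ′/p) = +1`), the twist
`E_{2p}^{(−5ℓ′)} = E_{2p·5ℓ′}` of analytic rank `0` (cell B, p644288) and `h(K′) < p` (`5ℓ′ < 5p`). The card states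
`CruxOnE2pCornerMod5` for all `p ≡ 3 (mod 4)`; its `p ≡ 3 (mod 8)` half needs a non-degenerate three-square
representation of `2p` (a representation count `r₃(2p) > 24`, not in the tree) and is NOT proved — the theorem below
carries the extra hypothesis `p % 8 = 7`. THEOREMS ONLY; the crux (all CM `W`) is NOT proved. Supports
stmt-BirchSwinnertonDyer-21381 (typed sub-corner rung).
-/

namespace Summit.BirchSwinnertonDyer.BirchSwinnertonDyer.Theorems.BiquadraticEisensteinDescentHeegnerTwistCouplingInSupplyThreeSquaresPinCornerDual

open Literature.NumberTheory.EllipticCurves Literature.NumberTheory.EllipticCurves.HeathBrown1994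
  Summit.BirchSwinnertonDyer.BirchSwinnertonDyer.Theorems.BiquadraticEisensteinDescentHeegnerTwistCouplingInSupplyThreeSquaresPinRankZero
  Summit.BirchSwinnertonDyer.BirchSwinnertonDyer.Theorems.BiquadraticEisensteinDescentHeegnerTwistCouplingInSupplyThreeSquaresPinCorner

/-- `5ℓ` is square-free for a prime `ℓ ≠ 5`. [folklore] -/
theorem squarefree_five_mul {l : ℕ} (hl : l.Prime) (hl5 : l ≠ 5) : Squarefree (5 * l) := by
  rw [Nat.squarefree_mul ((Nat.coprime_primes Nat.prime_five hl).mpr hl5.symm)]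
  exact ⟨Nat.prime_five.squarefree, hl.squarefree⟩

/-- **The witness field for the dual pin.** For primes `p ≥ 11` and `ℓ′ ≡ 3 (mod 8)` with `(−5ℓ′/p) = +1` and `5ℓ′ < 5p`:
`K′ = ℚ(√−5ℓ′)` is imaginary quadratic with `d_{K′} = −5ℓ′`, satisfies the Heegner hypothesis for every level `N` whose
prime divisors are among `{2, p}`, and `h(K′) < p`. [cite: Marcus2018, Ch. 2 Thm. 1; Ch. 3 Thm. 25]
[cite: Oesterle1988Gauss, II §3 Proposition p. 57 (27)] -/
theorem exists_witnessField_five {p l : ℕ} (hp : p.Prime) (hp11 : 11 ≤ p) (hl : l.Prime) (hl8 : l % 8 = 3)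
    (hJ5 : jacobiSym (-(5 * (l : ℤ))) p = 1) (hsz : 5 * l < 5 * p) {N : ℕ}
    (hN : ∀ q : ℕ, q.Prime → q ∣ N → q = 2 ∨ q = p) :
    ∃ (K : Type) (_ : Field K) (_ : NumberField K),
      IsImaginaryQuadratic K ∧ NumberField.discr K = -((5 * l : ℕ) : ℤ) ∧
      SatisfiesHeegnerHypothesis N K ∧ NumberField.classNumber K < p := by
  haveI : Fact ((-((5 * l : ℕ) : ℤ)) < 0) := ⟨by have := hl.two_le; omega⟩
  have hl5 : l ≠ 5 := by
    rintro rfl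
    omega
  have hsf : Squarefree (-((5 * l : ℕ) : ℤ)).natAbs := by
    rw [Int.natAbs_neg, Int.natAbs_natCast]
    exact squarefree_five_mul hl hl5
  have hD8 : (-((5 * l : ℕ) : ℤ)) % 8 = 1 := by omega
  obtain ⟨hK, hdK⟩ := isImaginaryQuadratic_and_discr_sqrtField_of_squarefree_natAbs (-((5 * l : ℕ) : ℤ))
    (by omega) hsf
  have hJ5' : jacobiSym (-((5 * l : ℕ) : ℤ)) p = 1 := by
    have : (-((5 * l : ℕ) : ℤ)) = -(5 * (l : ℤ)) := by push_cast; ring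
    rw [this]
    exact hJ5
  refine ⟨sqrtField (-((5 * l : ℕ) : ℤ)), inferInstance, inferInstance, hK, hdK, ?_, ?_⟩
  · refine satisfiesHeegnerHypothesis_sqrtField_of_squarefree_natAbs _ hD8 hsf fun q hq hqN => ?_
    rcases hN q hq hqN with rfl | rfl
    · exact Or.inl rfl
    · exact Or.inr hJ5'
  · refine classNumber_lt_of_natAbs_discr_lt_six_mul hK ?_ hp11 ?_
    · rw [hdK, Int.natAbs_neg, Int.natAbs_natCast]
      have := hl.two_le
      omega
    · rw [hdK, Int.natAbs_neg, Int.natAbs_natCast]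
      omega

/-- **`CruxOnE2pCornerMod5` on the `p ≡ 7 (mod 8)` half (card `three-squares-heegner-pin`; the card's signature with the
extra hypothesis `p % 8 = 7`), PROVED modulo Modularity + Monsky (even) + Burungale–Tian + Deuring–Hecke +
Burungale–Flach.** For every prime `p ≡ 7 (mod 8)`, `p ≡ ±1 (mod 5)`, `p > 11`: the dual pin `ℓ′` and the Heegner field
`K′ = ℚ(√−5ℓ′)` of `N(E_{2p}) = 64p²` with `L(E_{2p}^{(−5ℓ′)}, 1) ≠ 0` and `h(K′) < p`.
[cite: HeathBrown1994SelmerCongruentII, Appendix (Monsky), typescript p. 41 L20–L36] [cite: BurungaleTian2026, Thm. 1.1]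
[cite: BurungaleFlach2024, Thm. 1.1 and Cor. 2] [cite: KoblitzECMF1993, Ch. II §5, Theorem (p. 84)] -/
theorem cruxOnE2pCornerMod5_of_mod_eight_eq_seven_of_facts (hmod : ModularForms.exists_isNewformOf)
    (hM : monsky_card_selmerGroup_two_even)
    (hBT : burungaleTian_analyticRank_eq_zero_of_selmerCorank_eq_zero_of_hasCM)
    (hH : hasEntireLFunction_of_j_mem_maximalCMJInvariants) (hBF : bsdTriple_of_hasCM_of_L_one_ne_zero) :
    ∀ (p : ℕ) [Fact p.Prime] [(congruentNumberCurve (2 * p)).IsElliptic]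
      [(congruentNumberCurve (2 * p)).IsGloballyMinimal]
      [NeZero ((congruentNumberCurve (2 * p)).conductorNorm ℤ)],
      p % 8 = 7 → p % 4 = 3 → (p % 5 = 1 ∨ p % 5 = 4) → 11 < p →
      ∃ (ℓ : ℕ) (K : Type) (_ : Field K) (_ : NumberField K),
        ℓ.Prime ∧ ℓ < p ∧ ℓ % 8 = 3 ∧ jacobiSym (ℓ : ℤ) p = -1 ∧
        IsImaginaryQuadratic K ∧ NumberField.discr K = -((5 * ℓ : ℕ) : ℤ) ∧
        SatisfiesHeegnerHypothesis ((congruentNumberCurve (2 * p)).conductorNorm ℤ) K ∧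
        ((congruentNumberCurve (2 * p)).quadraticTwist (NumberField.discr K : ℚ)).entireLFunction 1 ≠ 0 ∧
        NumberField.classNumber K < p := by
  intro p hpF _ _ _ hp8 _ hp5 hp11
  have hp : p.Prime := hpF.out
  obtain ⟨ℓ, hℓ, hlt, hℓ8, hJ, -, hJ5, hsz, -, -, -, hL⟩ := exists_dualPin_analyticRank_eq_zero_two_p hM hBT hH hBF hp hp8 hp5
  have hsq2p : Squarefree (2 * p) := by
    rw [Nat.squarefree_mul ((Nat.coprime_primes Nat.prime_two hp).mpr (by omega))]
    exact ⟨Nat.prime_two.squarefree, hp.squarefree⟩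
  have hN : (congruentNumberCurve (2 * p)).conductorNorm ℤ = 64 * p ^ 2 :=
    (rootNumber_eq_and_conductorNorm_congruentNumberCurve_two_mul hmod hsq2p).2
  obtain ⟨K, iF, iN, hK, hdK, hH', hh⟩ := exists_witnessField_five (N := (congruentNumberCurve (2 * p)).conductorNorm ℤ)
    hp (by omega) hℓ hℓ8 hJ5 hsz (fun q hq hqN => eq_two_or_eq_of_prime_dvd_sixtyFour_mul_sq hp hq (hN ▸ hqN))
  refine ⟨ℓ, K, iF, iN, hℓ, hlt, hℓ8, hJ, hK, hdK, hH', ?_, hh⟩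
  rw [hdK, quadraticTwist_congruentNumberCurve, Int.natAbs_neg, Int.natAbs_natCast]
  have h55 : 2 * p * (5 * ℓ) = 2 * p * (ℓ * 5) := by ring
  rw [h55]
  exact hL

end Summit.BirchSwinnertonDyer.BirchSwinnertonDyer.Theorems.BiquadraticEisensteinDescentHeegnerTwistCouplingInSupplyThreeSquaresPinCornerDual
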